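import Summits.CriticalPhenomena.CardyFormulaZ2.Theorems.CardyFlipRussoVoronoiHubFromSmirnovDefs
import Mathlib

/-!
# Helper `crossRatio_holomorphic_distortion` — line `moebius-exact-delaunay-dilation-ward`,
# stub S3 `stub_conformalTransport` (crux `VoronoiHubFromSmirnov`, stmt-CriticalPhenomena-6433)

Conformal transport of Voronoi percolation (Benjamini–Schramm 1998, Thm 2.1) rests on the fact that
a conformal map agrees with a Möbius map to second order: it multiplies the cross-ratio of four
points of diameter `≤ r` by `1 + O(r²)` (BS98 Lemma 4.1 and the planar remark following it).  Since
the Delaunay empty-circle test is a sign test on the same cross-ratio, this makes Delaunay/Voronoi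
adjacency robust under conformal maps at small scales.

We prove the elementary, quantitative `C¹'¹` form `crossRatio_holomorphic_distortion`: if on a
convex set `B` the map `h` has complex derivative `h₁`, `h₁` has complex derivative `h₂`,
`‖h₁‖ ≥ m > 0`, `‖h₂‖ ≤ L` and `h₂` is `L`-Lipschitz, then for four distinct points `z i ∈ B` of
mutual distances `≤ r ≤ r₀` the cross-ratio
`(h z₀ - h z₂)(h z₁ - h z₃)(z₀ - z₃)(z₁ - z₂) / ((h z₀ - h z₃)(h z₁ - h z₂)(z₀ - z₂)(z₁ - z₃))`
differs from `1` by at most `C r²`, with `r₀ = min 1 (m / (4 (L + 1)))` and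
`C = 16 (L/m) + 32 (L/m)²`.

Proof (no Cauchy integrals).  Put `c = z₀`, `a = h₁ c`, `b = h₂ c` and work on the convex set
`S = B ∩ closedBall c r`.  (1) The mean value inequality applied to `w ↦ h₁ w - b w` (derivative
`h₂ w - b`, of norm `≤ L r` on `S`) gives `‖h₁ w - a - b (w - c)‖ ≤ L r²` (`crd_taylor_remainder`).
(2) Applied to `w ↦ h w - a w - (b/2)(w - c)²` (derivative bounded by (1)) it gives, for the secant
slopes `g_{ij} = (h zᵢ - h zⱼ)/(zᵢ - zⱼ)` and midpoints `u_{ij} = (zᵢ + zⱼ)/2 - c`, the estimate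
`‖g_{ij} - a - b u_{ij}‖ ≤ L r²` (`crd_secant_remainder`), while `‖u_{ij}‖ ≤ r`.  (3) The quantity
in question equals `g₀₂ g₁₃ / (g₀₃ g₁₂) - 1` (`crd_crossRatio_sub_one_eq`); in the numerator
`g₀₂ g₁₃ - g₀₃ g₁₂` the first-order term cancels because `u₀₂ + u₁₃ = u₀₃ + u₁₂`
(`crd_numerator_eq`), leaving `O(r²)` (`crd_numerator_norm_le`), and the denominator is `≥ ‖a‖²/4`
for `r ≤ r₀` (`crd_final_bound`).  All [folklore]; context: I. Benjamini, O. Schramm, *Conformal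
invariance of Voronoi percolation*, Comm. Math. Phys. 197 (1998) 75–107, Lemma 4.1.
-/

noncomputable section

namespace Summit.CriticalPhenomena.CardyFormulaZ2.Cruxes.VoronoiHubFromSmirnov.MoebiusExactDelaunayDilationWard

open Set Metric

/-! ### Steps 1–2: second-order Taylor control from the mean value inequality -/

/-- **Step 1.** On a convex set `S ∋ c` contained in the ball of radius `r` about `c`, if `h₁` has
derivative `h₂` within `S` and `‖h₂ w - h₂ c‖ ≤ L r` on `S`, then the affine Taylor remainder of
`h₁` at `c` is at most `L r²` on `S`. [folklore] -/
theorem crd_taylor_remainder {h₁ h₂ : ℂ → ℂ} {S : Set ℂ} {c : ℂ} {L r : ℝ} (hS : Convex ℝ S)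
    (hd2 : ∀ w ∈ S, HasDerivWithinAt h₁ (h₂ w) S w) (hc : c ∈ S)
    (hball : ∀ w ∈ S, ‖w - c‖ ≤ r) (hLip : ∀ w ∈ S, ‖h₂ w - h₂ c‖ ≤ L * r) (hr : 0 ≤ r)
    (hL : 0 ≤ L) {w : ℂ} (hw : w ∈ S) :
    ‖h₁ w - h₁ c - h₂ c * (w - c)‖ ≤ L * r ^ 2 := by
  have hder : ∀ x ∈ S, HasDerivWithinAt (fun y => h₁ y - h₂ c * y) (h₂ x - h₂ c) S x := by
    intro x hx
    have hid : HasDerivWithinAt (fun y : ℂ => y) 1 S x := hasDerivWithinAt_id x S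
    exact ((hd2 x hx).fun_sub (hid.const_mul (h₂ c))).congr_deriv (by rw [mul_one])
  have key : ‖(h₁ w - h₂ c * w) - (h₁ c - h₂ c * c)‖ ≤ L * r * ‖w - c‖ :=
    hS.norm_image_sub_le_of_norm_hasDerivWithin_le hder hLip hc hw
  have e : (h₁ w - h₂ c * w) - (h₁ c - h₂ c * c) = h₁ w - h₁ c - h₂ c * (w - c) := by ring
  rw [e] at key
  have hLr : 0 ≤ L * r := mul_nonneg hL hr
  calc ‖h₁ w - h₁ c - h₂ c * (w - c)‖ ≤ L * r * ‖w - c‖ := key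
    _ ≤ L * r * r := mul_le_mul_of_nonneg_left (hball w hw) hLr
    _ = L * r ^ 2 := by ring

/-- **Step 2.** Under the hypotheses of Step 1, and if moreover `h` has derivative `h₁` within `S`,
the secant slope of `h` between two distinct points `x, y ∈ S` is `h₁ c + h₂ c ((x + y)/2 - c)` up
to an error of norm `≤ L r²`. [folklore] -/
theorem crd_secant_remainder {h h₁ h₂ : ℂ → ℂ} {S : Set ℂ} {c : ℂ} {L r : ℝ} (hS : Convex ℝ S)
    (hd1 : ∀ w ∈ S, HasDerivWithinAt h (h₁ w) S w)
    (hd2 : ∀ w ∈ S, HasDerivWithinAt h₁ (h₂ w) S w) (hc : c ∈ S)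
    (hball : ∀ w ∈ S, ‖w - c‖ ≤ r) (hLip : ∀ w ∈ S, ‖h₂ w - h₂ c‖ ≤ L * r) (hr : 0 ≤ r)
    (hL : 0 ≤ L) {x y : ℂ} (hx : x ∈ S) (hy : y ∈ S) (hxy : x ≠ y) :
    ‖(h x - h y) / (x - y) - h₁ c - h₂ c * ((x + y) / 2 - c)‖ ≤ L * r ^ 2 := by
  have hder : ∀ w ∈ S, HasDerivWithinAt
      (fun y => h y - h₁ c * y - h₂ c / 2 * ((y - c) * (y - c)))
      (h₁ w - h₁ c - h₂ c * (w - c)) S w := by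
    intro w hw
    have hid : HasDerivWithinAt (fun y : ℂ => y) 1 S w := hasDerivWithinAt_id w S
    have h1 := ((hd1 w hw).fun_sub (hid.const_mul (h₁ c))).fun_sub
      (((hid.sub_const c).fun_mul (hid.sub_const c)).const_mul (h₂ c / 2))
    exact h1.congr_deriv (by ring)
  have hbound : ∀ w ∈ S, ‖h₁ w - h₁ c - h₂ c * (w - c)‖ ≤ L * r ^ 2 := fun w hw =>
    crd_taylor_remainder hS hd2 hc hball hLip hr hL hw
  have key : ‖(h x - h₁ c * x - h₂ c / 2 * ((x - c) * (x - c))) -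
      (h y - h₁ c * y - h₂ c / 2 * ((y - c) * (y - c)))‖ ≤ L * r ^ 2 * ‖x - y‖ :=
    hS.norm_image_sub_le_of_norm_hasDerivWithin_le hder hbound hy hx
  have hxy' : x - y ≠ 0 := sub_ne_zero.2 hxy
  have e : (h x - h₁ c * x - h₂ c / 2 * ((x - c) * (x - c))) -
      (h y - h₁ c * y - h₂ c / 2 * ((y - c) * (y - c))) =
      (x - y) * ((h x - h y) / (x - y) - h₁ c - h₂ c * ((x + y) / 2 - c)) := by
    field_simp
    ring
  rw [e, norm_mul] at key
  have hpos : 0 < ‖x - y‖ := norm_pos_iff.2 hxy'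
  have key' : ‖x - y‖ * ‖(h x - h y) / (x - y) - h₁ c - h₂ c * ((x + y) / 2 - c)‖ ≤
      ‖x - y‖ * (L * r ^ 2) := by linarith
  exact le_of_mul_le_mul_left key' hpos

/-- The midpoint of two points of the ball of radius `r` about `c` is within `r` of `c`.
[folklore] -/
theorem crd_midpoint_norm_le {x y c : ℂ} {r : ℝ} (hx : ‖x - c‖ ≤ r) (hy : ‖y - c‖ ≤ r) :
    ‖(x + y) / 2 - c‖ ≤ r := by
  have e : (x + y) / 2 - c = ((x - c) + (y - c)) / 2 := by ring
  rw [e, norm_div, RCLike.norm_ofNat]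
  have := norm_add_le (x - c) (y - c)
  linarith

/-! ### Step 3: algebra of the cross-ratio of the images -/

/-- The cross-ratio of the images, divided by the cross-ratio of the points, minus one, in terms of
the secant slopes `g_{ij}` (`Hᵢ - Hⱼ = g_{ij} (zᵢ - zⱼ)`):  it equals
`(g₀₂ g₁₃ - g₀₃ g₁₂)/(g₀₃ g₁₂)`. [folklore] -/
theorem crd_crossRatio_sub_one_eq (H0 H1 H2 H3 z0 z1 z2 z3 g02 g13 g03 g12 : ℂ)
    (hz02 : z0 ≠ z2) (hz03 : z0 ≠ z3) (hz12 : z1 ≠ z2) (hz13 : z1 ≠ z3)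
    (hg03 : g03 ≠ 0) (hg12 : g12 ≠ 0)
    (e02 : H0 - H2 = g02 * (z0 - z2)) (e13 : H1 - H3 = g13 * (z1 - z3))
    (e03 : H0 - H3 = g03 * (z0 - z3)) (e12 : H1 - H2 = g12 * (z1 - z2)) :
    (H0 - H2) * (H1 - H3) * ((z0 - z3) * (z1 - z2)) /
        ((H0 - H3) * (H1 - H2) * ((z0 - z2) * (z1 - z3))) - 1 =
      (g02 * g13 - g03 * g12) / (g03 * g12) := by
  have hz02' : z0 - z2 ≠ 0 := sub_ne_zero.2 hz02
  have hz03' : z0 - z3 ≠ 0 := sub_ne_zero.2 hz03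
  have hz12' : z1 - z2 ≠ 0 := sub_ne_zero.2 hz12
  have hz13' : z1 - z3 ≠ 0 := sub_ne_zero.2 hz13
  have hB : g03 * (z0 - z3) * (g12 * (z1 - z2)) * ((z0 - z2) * (z1 - z3)) ≠ 0 :=
    mul_ne_zero (mul_ne_zero (mul_ne_zero hg03 hz03') (mul_ne_zero hg12 hz12'))
      (mul_ne_zero hz02' hz13')
  have hD : g03 * g12 ≠ 0 := mul_ne_zero hg03 hg12
  rw [e02, e13, e03, e12, div_sub_one hB, div_eq_div_iff hB hD]
  ring

/-- The numerator identity: writing `g_{ij} = a + b u_{ij} + E_{ij}`, the first-order terms of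
`g₀₂ g₁₃ - g₀₃ g₁₂` cancel because `u₀₂ + u₁₃ = u₀₃ + u₁₂`. [folklore] -/
theorem crd_numerator_eq (a b g02 g13 g03 g12 u02 u13 u03 u12 : ℂ)
    (hu : u02 + u13 = u03 + u12) :
    g02 * g13 - g03 * g12 =
      a * ((g02 - a - b * u02) + (g13 - a - b * u13) - (g03 - a - b * u03) - (g12 - a - b * u12)) +
      b ^ 2 * (u02 * u13 - u03 * u12) +
      b * (u02 * (g13 - a - b * u13) + u13 * (g02 - a - b * u02) - u03 * (g12 - a - b * u12) -
        u12 * (g03 - a - b * u03)) +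
      ((g02 - a - b * u02) * (g13 - a - b * u13) - (g03 - a - b * u03) * (g12 - a - b * u12)) := by
  linear_combination (a * b) * hu

/-- Norm bound for the numerator: with `‖b‖ ≤ L`, `‖u_{ij}‖ ≤ r ≤ 1` and `‖E_{ij}‖ ≤ L r²`, the
right-hand side of `crd_numerator_eq` has norm `≤ (4 L ‖a‖ + 8 L²) r²`. [folklore] -/
theorem crd_numerator_norm_le (a b u02 u13 u03 u12 E02 E13 E03 E12 : ℂ) {L r : ℝ} (hL : 0 ≤ L)
    (hr0 : 0 ≤ r) (hr1 : r ≤ 1) (hb : ‖b‖ ≤ L) (hu02 : ‖u02‖ ≤ r) (hu13 : ‖u13‖ ≤ r)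
    (hu03 : ‖u03‖ ≤ r) (hu12 : ‖u12‖ ≤ r) (hE02 : ‖E02‖ ≤ L * r ^ 2) (hE13 : ‖E13‖ ≤ L * r ^ 2)
    (hE03 : ‖E03‖ ≤ L * r ^ 2) (hE12 : ‖E12‖ ≤ L * r ^ 2) :
    ‖a * (E02 + E13 - E03 - E12) + b ^ 2 * (u02 * u13 - u03 * u12) +
        b * (u02 * E13 + u13 * E02 - u03 * E12 - u12 * E03) + (E02 * E13 - E03 * E12)‖ ≤
      (4 * L * ‖a‖ + 8 * L ^ 2) * r ^ 2 := by
  have e0 : 0 ≤ L * r ^ 2 := by positivity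
  have h1 : ‖E02 + E13 - E03 - E12‖ ≤ 4 * (L * r ^ 2) :=
    (norm_sub_le_of_le (norm_sub_le_of_le (norm_add_le_of_le hE02 hE13) hE03) hE12).trans
      (by linarith)
  have hmul : ∀ {p q : ℂ} {s t : ℝ}, ‖p‖ ≤ s → ‖q‖ ≤ t → 0 ≤ s → ‖p * q‖ ≤ s * t :=
    fun hp hq hs => (norm_mul _ _).trans_le (mul_le_mul hp hq (norm_nonneg _) hs)
  have h2 : ‖u02 * u13 - u03 * u12‖ ≤ 2 * (r * r) :=
    (norm_sub_le_of_le (hmul hu02 hu13 hr0) (hmul hu03 hu12 hr0)).trans (by linarith)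
  have h3 : ‖u02 * E13 + u13 * E02 - u03 * E12 - u12 * E03‖ ≤ 4 * (r * (L * r ^ 2)) :=
    (norm_sub_le_of_le (norm_sub_le_of_le (norm_add_le_of_le (hmul hu02 hE13 hr0)
      (hmul hu13 hE02 hr0)) (hmul hu03 hE12 hr0)) (hmul hu12 hE03 hr0)).trans (by linarith)
  have h4 : ‖E02 * E13 - E03 * E12‖ ≤ 2 * ((L * r ^ 2) * (L * r ^ 2)) :=
    (norm_sub_le_of_le (hmul hE02 hE13 e0) (hmul hE03 hE12 e0)).trans (by linarith)
  have hA : ‖a * (E02 + E13 - E03 - E12)‖ ≤ ‖a‖ * (4 * (L * r ^ 2)) :=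
    (norm_mul _ _).trans_le (mul_le_mul_of_nonneg_left h1 (norm_nonneg _))
  have hB : ‖b ^ 2 * (u02 * u13 - u03 * u12)‖ ≤ L ^ 2 * (2 * (r * r)) := by
    rw [norm_mul, norm_pow]
    exact mul_le_mul (pow_le_pow_left₀ (norm_nonneg _) hb 2) h2 (norm_nonneg _) (by positivity)
  have hC : ‖b * (u02 * E13 + u13 * E02 - u03 * E12 - u12 * E03)‖ ≤
      L * (4 * (r * (L * r ^ 2))) := hmul hb h3 hL
  have hr3 : r ^ 3 ≤ r ^ 2 := pow_le_pow_of_le_one hr0 hr1 (by norm_num)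
  have hr4 : r ^ 4 ≤ r ^ 2 := pow_le_pow_of_le_one hr0 hr1 (by norm_num)
  have hL2 : 0 ≤ L ^ 2 := sq_nonneg L
  calc _ ≤ ‖a‖ * (4 * (L * r ^ 2)) + L ^ 2 * (2 * (r * r)) + L * (4 * (r * (L * r ^ 2))) +
        2 * ((L * r ^ 2) * (L * r ^ 2)) :=
          norm_add_le_of_le (norm_add_le_of_le (norm_add_le_of_le hA hB) hC) h4
    _ = 4 * L * ‖a‖ * r ^ 2 + 2 * L ^ 2 * r ^ 2 + 4 * L ^ 2 * r ^ 3 + 2 * L ^ 2 * r ^ 4 := by ring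
    _ ≤ 4 * L * ‖a‖ * r ^ 2 + 2 * L ^ 2 * r ^ 2 + 4 * L ^ 2 * r ^ 2 + 2 * L ^ 2 * r ^ 2 := by
          have h3' : 4 * L ^ 2 * r ^ 3 ≤ 4 * L ^ 2 * r ^ 2 :=
            mul_le_mul_of_nonneg_left hr3 (by positivity)
          have h4' : 2 * L ^ 2 * r ^ 4 ≤ 2 * L ^ 2 * r ^ 2 :=
            mul_le_mul_of_nonneg_left hr4 (by positivity)
          linarith
    _ = (4 * L * ‖a‖ + 8 * L ^ 2) * r ^ 2 := by ring

/-- **Step 3, assembled.** If `‖a‖ ≥ m > 0`, `‖b‖ ≤ L`, `‖u_{ij}‖ ≤ r`, `u₀₂ + u₁₃ = u₀₃ + u₁₂`,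
`‖g_{ij} - a - b u_{ij}‖ ≤ L r²`, `0 ≤ r ≤ 1` and `L r ≤ m/4`, then `g₀₃, g₁₂ ≠ 0` and
`‖(g₀₂ g₁₃ - g₀₃ g₁₂)/(g₀₃ g₁₂)‖ ≤ (16 (L/m) + 32 (L/m)²) r²`. [folklore] -/
theorem crd_final_bound (a b g02 g13 g03 g12 u02 u13 u03 u12 : ℂ) {L m r : ℝ} (hm : 0 < m)
    (hL : 0 ≤ L) (hr0 : 0 ≤ r) (hr1 : r ≤ 1) (hLr : L * r ≤ m / 4) (ha : m ≤ ‖a‖)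
    (hb : ‖b‖ ≤ L) (hu02 : ‖u02‖ ≤ r) (hu13 : ‖u13‖ ≤ r) (hu03 : ‖u03‖ ≤ r) (hu12 : ‖u12‖ ≤ r)
    (husum : u02 + u13 = u03 + u12) (hE02 : ‖g02 - a - b * u02‖ ≤ L * r ^ 2)
    (hE13 : ‖g13 - a - b * u13‖ ≤ L * r ^ 2) (hE03 : ‖g03 - a - b * u03‖ ≤ L * r ^ 2)
    (hE12 : ‖g12 - a - b * u12‖ ≤ L * r ^ 2) :
    g03 ≠ 0 ∧ g12 ≠ 0 ∧
      ‖(g02 * g13 - g03 * g12) / (g03 * g12)‖ ≤ (16 * (L / m) + 32 * (L / m) ^ 2) * r ^ 2 := by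
  have hr2 : r ^ 2 ≤ r := pow_le_of_le_one hr0 hr1 two_ne_zero
  have hLr2 : L * r ^ 2 ≤ L * r := mul_le_mul_of_nonneg_left hr2 hL
  -- lower bound on the slopes
  have low : ∀ g u : ℂ, ‖u‖ ≤ r → ‖g - a - b * u‖ ≤ L * r ^ 2 → ‖a‖ / 2 ≤ ‖g‖ := by
    intro g u hu hE
    have h3 : ‖g - a‖ ≤ ‖b * u‖ + ‖g - a - b * u‖ := by
      have := norm_add_le (b * u) (g - a - b * u)
      rwa [add_sub_cancel] at this
    have h4 : ‖b * u‖ ≤ L * r := (norm_mul _ _).trans_le (mul_le_mul hb hu (norm_nonneg _) hL)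
    have h5 : ‖a‖ - ‖g‖ ≤ ‖g - a‖ := by rw [norm_sub_rev]; exact norm_sub_norm_le a g
    linarith
  have hg03 := low g03 u03 hu03 hE03
  have hg12 := low g12 u12 hu12 hE12
  have ha0 : 0 < ‖a‖ := hm.trans_le ha
  have hg03pos : 0 < ‖g03‖ := by linarith
  have hg12pos : 0 < ‖g12‖ := by linarith
  refine ⟨norm_pos_iff.1 hg03pos, norm_pos_iff.1 hg12pos, ?_⟩
  rw [crd_numerator_eq a b g02 g13 g03 g12 u02 u13 u03 u12 husum, norm_div, norm_mul,
    div_le_iff₀ (mul_pos hg03pos hg12pos)]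
  refine (crd_numerator_norm_le a b u02 u13 u03 u12 _ _ _ _ hL hr0 hr1 hb hu02 hu13 hu03 hu12
    hE02 hE13 hE03 hE12).trans ?_
  have hKa : L ≤ L / m * ‖a‖ := by
    rw [div_mul_eq_mul_div, le_div_iff₀ hm]
    exact mul_le_mul_of_nonneg_left ha hL
  have hK0 : 0 ≤ L / m := div_nonneg hL hm.le
  have hgg : ‖a‖ / 2 * (‖a‖ / 2) ≤ ‖g03‖ * ‖g12‖ :=
    mul_le_mul hg03 hg12 (by positivity) (norm_nonneg _)
  have hcoef : 0 ≤ (16 * (L / m) + 32 * (L / m) ^ 2) * r ^ 2 := by positivity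
  calc (4 * L * ‖a‖ + 8 * L ^ 2) * r ^ 2
      ≤ (4 * (L / m * ‖a‖) * ‖a‖ + 8 * (L / m * ‖a‖) ^ 2) * r ^ 2 :=
        mul_le_mul_of_nonneg_right (add_le_add
          (mul_le_mul_of_nonneg_right (mul_le_mul_of_nonneg_left hKa (by norm_num)) (norm_nonneg a))
          (mul_le_mul_of_nonneg_left (pow_le_pow_left₀ hL hKa 2) (by norm_num))) (sq_nonneg r)
    _ = (16 * (L / m) + 32 * (L / m) ^ 2) * r ^ 2 * (‖a‖ / 2 * (‖a‖ / 2)) := by ring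
    _ ≤ (16 * (L / m) + 32 * (L / m) ^ 2) * r ^ 2 * (‖g03‖ * ‖g12‖) :=
        mul_le_mul_of_nonneg_left hgg hcoef

/-! ### The stub -/

/-- **BS98 Lemma 4.1 (planar, cross-ratio form): a conformal map distorts small cross-ratios by
`1 + O(r²)`.**  If on a convex set `B` the map `h` has complex derivative `h₁`, `h₁` has complex
derivative `h₂`, `‖h₁‖ ≥ m > 0`, `‖h₂‖ ≤ L` and `h₂` is `L`-Lipschitz on `B`, then there are `C`
and `r₀ > 0` such that for every `r ≤ r₀` and every injective `z : Fin 4 → B` with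
`‖z i - z j‖ ≤ r`, the cross-ratio `(h z₀ - h z₂)(h z₁ - h z₃)/((h z₀ - h z₃)(h z₁ - h z₂))` of the
images equals the cross-ratio of the points times a factor within `C r²` of `1`.  (Explicitly
`r₀ = min 1 (m/(4(L+1)))`, `C = 16 L/m + 32 (L/m)²`.) -/
theorem crossRatio_holomorphic_distortion : ∀ (h h₁ h₂ : ℂ → ℂ) (B : Set ℂ) (L m : ℝ), Convex ℝ B → 0 < m → (∀ z ∈ B, HasDerivAt h (h₁ z) z) → (∀ z ∈ B, HasDerivAt h₁ (h₂ z) z) → (∀ z ∈ B, m ≤ ‖h₁ z‖) → (∀ z ∈ B, ‖h₂ z‖ ≤ L) → (∀ z ∈ B, ∀ w ∈ B, ‖h₂ z - h₂ w‖ ≤ L * ‖z - w‖) → ∃ C r₀ : ℝ, 0 < r₀ ∧ ∀ (r : ℝ) (z : Fin 4 → ℂ), r ≤ r₀ → (∀ i, z i ∈ B) → Function.Injective z → (∀ i j, ‖z i - z j‖ ≤ r) → ‖(h (z 0) - h (z 2)) * (h (z 1) - h (z 3)) * ((z 0 - z 3) * (z 1 - z 2)) / ((h (z 0) - h (z 3))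 * (h (z 1) - h (z 2)) * ((z 0 - z 2) * (z 1 - z 3))) - 1‖ ≤ C * r ^ 2 := by
  intro h h₁ h₂ B L m hB hm hd1 hd2 hm1 hL2 hLip
  by_cases hL : 0 ≤ L
  swap
  · refine ⟨0, 1, one_pos, fun r z _ hzB _ _ => ?_⟩
    exact absurd ((norm_nonneg _).trans (hL2 (z 0) (hzB 0))) hL
  refine ⟨16 * (L / m) + 32 * (L / m) ^ 2, min 1 (m / (4 * (L + 1))),
    lt_min one_pos (by positivity), fun r z hr hzB hzinj hzd => ?_⟩
  have hr0 : 0 ≤ r := (norm_nonneg _).trans (hzd 0 0)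
  have hr1 : r ≤ 1 := hr.trans (min_le_left _ _)
  have hrm : r ≤ m / (4 * (L + 1)) := hr.trans (min_le_right _ _)
  have hLr : L * r ≤ m / 4 := by
    have h4 : r * (4 * (L + 1)) ≤ m := (le_div_iff₀ (by positivity)).1 hrm
    nlinarith
  -- the local convex set around `c = z 0`
  have hS : Convex ℝ (B ∩ closedBall (z 0) r) := hB.inter (convex_closedBall (z 0) r)
  have hzS : ∀ i, z i ∈ B ∩ closedBall (z 0) r := fun i =>
    ⟨hzB i, mem_closedBall_iff_norm.2 (hzd i 0)⟩
  have hcS : z 0 ∈ B ∩ closedBall (z 0) r := hzS 0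
  have hd1S : ∀ w ∈ B ∩ closedBall (z 0) r, HasDerivWithinAt h (h₁ w) (B ∩ closedBall (z 0) r) w :=
    fun w hw => (hd1 w hw.1).hasDerivWithinAt
  have hd2S : ∀ w ∈ B ∩ closedBall (z 0) r,
      HasDerivWithinAt h₁ (h₂ w) (B ∩ closedBall (z 0) r) w :=
    fun w hw => (hd2 w hw.1).hasDerivWithinAt
  have hball : ∀ w ∈ B ∩ closedBall (z 0) r, ‖w - z 0‖ ≤ r := fun w hw =>
    mem_closedBall_iff_norm.1 hw.2
  have hLipS : ∀ w ∈ B ∩ closedBall (z 0) r, ‖h₂ w - h₂ (z 0)‖ ≤ L * r := fun w hw =>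
    (hLip w hw.1 (z 0) hcS.1).trans (mul_le_mul_of_nonneg_left (hball w hw) hL)
  have ha : m ≤ ‖h₁ (z 0)‖ := hm1 (z 0) hcS.1
  have hb : ‖h₂ (z 0)‖ ≤ L := hL2 (z 0) hcS.1
  -- second-order control of the secant slopes, and midpoints
  have hE : ∀ {i j : Fin 4}, i ≠ j → ‖(h (z i) - h (z j)) / (z i - z j) - h₁ (z 0) -
      h₂ (z 0) * ((z i + z j) / 2 - z 0)‖ ≤ L * r ^ 2 := fun hij =>
    crd_secant_remainder hS hd1S hd2S hcS hball hLipS hr0 hL (hzS _) (hzS _) (hzinj.ne hij)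
  have hu : ∀ i j : Fin 4, ‖(z i + z j) / 2 - z 0‖ ≤ r := fun i j =>
    crd_midpoint_norm_le (hball _ (hzS i)) (hball _ (hzS j))
  have heq : ∀ {i j : Fin 4}, i ≠ j →
      h (z i) - h (z j) = (h (z i) - h (z j)) / (z i - z j) * (z i - z j) :=
    fun hij => (div_mul_cancel₀ _ (sub_ne_zero.2 (hzinj.ne hij))).symm
  have h02 : (0 : Fin 4) ≠ 2 := by decide
  have h13 : (1 : Fin 4) ≠ 3 := by decide
  have h03 : (0 : Fin 4) ≠ 3 := by decide
  have h12 : (1 : Fin 4) ≠ 2 := by decide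
  obtain ⟨hg03, hg12, hbound⟩ := crd_final_bound (h₁ (z 0)) (h₂ (z 0))
    ((h (z 0) - h (z 2)) / (z 0 - z 2)) ((h (z 1) - h (z 3)) / (z 1 - z 3))
    ((h (z 0) - h (z 3)) / (z 0 - z 3)) ((h (z 1) - h (z 2)) / (z 1 - z 2))
    ((z 0 + z 2) / 2 - z 0) ((z 1 + z 3) / 2 - z 0) ((z 0 + z 3) / 2 - z 0) ((z 1 + z 2) / 2 - z 0)
    hm hL hr0 hr1 hLr ha hb (hu 0 2) (hu 1 3) (hu 0 3) (hu 1 2) (by ring)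
    (hE h02) (hE h13) (hE h03) (hE h12)
  rw [crd_crossRatio_sub_one_eq (h (z 0)) (h (z 1)) (h (z 2)) (h (z 3)) (z 0) (z 1) (z 2) (z 3)
    _ _ _ _ (hzinj.ne h02) (hzinj.ne h03) (hzinj.ne h12) (hzinj.ne h13) hg03 hg12
    (heq h02) (heq h13) (heq h03) (heq h12)]
  exact hbound

end Summit.CriticalPhenomena.CardyFormulaZ2.Cruxes.VoronoiHubFromSmirnov.MoebiusExactDelaunayDilationWard

end
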